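import Summits.QuantumFields.YangMills.Theorems.BalabanUVNodesN07HessOpOfRecordSymmetric
import Summits.QuantumFields.YangMills.Theorems.BalabanUVNodesN07FrakGOfRecordSliceFlat
import HarnessLib

/-!
# NODE N07 — [B9] (3.119) AT THE FLAT ORBIT: `π†Δ(u•1)π = Δ(u•1)` FOR EVERY `G′`, `Q′` (the slot-(b)∕(c) Hessian of ✓3f′ with `Δ⁽²⁾ = 0` IS the bare Hessian there), SO THE
# DISPLAYED `hposπ` ([B9] Thm 3.12) IS g24's PROVED flat `hpos` ([B9] Thm 3.11 at `u•1`), AND `𝔊(u•1)` OF SLOT (b) MAPS THE CURRENTS INTO (102) WITH NO DISPLAYED LETTER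

Cell `pub-ymgap`, width seat `pub-ymgap-dag-n07-w3` (g25), INTENT-13 ∕ CLAIM-13.  `--kind proof --supports stmt-QuantumFields-27238 --as helper`; count-neutral.
[15] = [Balaban1985Variational]; [B9] = [Balaban1985BackgroundPropagators].

WHAT.  Print's `π = 1 − DG′RD*` differs from `1` by a gauge mode `D(·)`; at a background whose Hessian kills EVERY gauge mode (`Δ(U₀)(D_{U₀}λ) = 0` for all `λ` — the flat orbit,
g24's ✓`hessOpOfRecord_one_covDerivL2K` ∕ ✓`hessOpOfRecord_pureGauge_covDerivL2K`; false off it, [B9] (3.117)) and is symmetric (✓p819846 `hessOpOfRecord_isSymmetric`, every background),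
`π†Δπ = Δ`:
* §1 ★ `hessOpOfRecordPi_eq_of_gaugeModes` — the generic sentence at the record; `hessOpOfRecordPi_one`, `hessOpOfRecordPi_pureGauge`, `hessOpOfRecord128_one_zero`,
  `hessOpOfRecord128_pureGauge_zero` (3f′'s slot handles at `u•1`, `Δ⁽²⁾ = 0`, ANY `G′`, `Q′`); the `u = 1` case is also lit ✓`adjoint_pi_hessOp_one_pi`.
* §2 ★★ `laplaceAOfRecordAt128_one_zero_pos`, `laplaceAOfRecordAt128_pureGauge_zero_pos` — the displayed `hposπ` of ✓3f′∕3g′ HOLDS at `U₀ = u•1`, `Δ⁽²⁾ = 0`, `0 < a`, `k ≤ m+K`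
  (= g24's ✓`laplaceAOfRecord_one_flat_pos` ∕ ✓`laplaceAOfRecord_pureGauge_pos`): the slot-(c) positivity binder is INHABITED on the flat orbit.
* §3 ★★★ `frakGOfRecordAtBg128_pureGauge_zero_mem_constraint102` — at `U₀ = u•1`, `Δ⁽²⁾ = 0`, print's `G′ := (T′)⁻¹`: `𝔊(u•1) f ∈ (102)` for every current `f` with NO displayed
  letter (`hposπ` := §2, `hQ` := ✓`QOfRecord_surjective_gaugeAct_one`, guard := ✓`smallBelow_gaugeAct` ∘ ✓`smallBelow_one`; ✓p819846 `frakGOfRecordAtBg128_mem_constraint102`).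

HONEST LABELS.  Flat-orbit identities and packaging of landed theorems; NO estimate off the flat orbit ([B9] Thm 3.11∕3.12 at a general background stay displayed), no constant.
Count-neutral; N07 NOT discharged; P0 ⟨26900⟩ OPEN; R4 is the conditional finite-𝕋⁴ rung only.  Nothing here is a claim about the Yang–Mills mass gap (`Summit.QuantumFields`):
finite torus, fixed `ε`; nothing continuum ∕ OS ∕ Clay.
-/

set_option autoImplicit false

noncomputable section

open scoped Matrix Matrix.Norms.L2Operator InnerProductSpace ComplexConjugate

namespace Summit.QuantumFields.YangMills.Theorems.N07HessOpOfRecordPiFlat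

open Literature.MathematicalPhysics.QuantumFieldTheory.Balaban1983to89
open Literature.MathematicalPhysics.QuantumFieldTheory.Balaban1983to89.T4Continuum (T4Family)
open T4Continuum BlockAveraging
open B9Eq311L2Pairing (WL2)
open B11Eq111FrakG (nabla115 constraint102)
open B11Eq103H1Complex (SiteL2K BondL2K covDerivL2K covDivL2K covLaplaceSiteK greenK QFun DstarFun)
open Node00
open GaugeField (gaugeAct)
open Summit.QuantumFields.YangMills.Theorems.N07HessOpOfRecordSymmetric (hessOpOfRecord_isSymmetric frakGOfRecordAtBg128_mem_constraint102)
open Summit.QuantumFields.YangMills.Theorems.N07FrakGOfRecordSliceFlat (hessOpOfRecord_one_covDerivL2K hessOpOfRecord_pureGauge_covDerivL2K)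
open Summit.QuantumFields.YangMills.Theorems.N07LaplaceAOfRecordFlatPos (laplaceAOfRecord_one_flat_pos)
open Summit.QuantumFields.YangMills.Theorems.N07LaplaceAOfRecordGaugeOrbitPos (laplaceAOfRecord_pureGauge_pos smallBelow_one)
open Summit.QuantumFields.YangMills.BalabanUVNodes.N07QOfRecordOntoSmallField (QOfRecord_surjective_gaugeAct_one)

variable (F : T4Family) (N : ℕ) [NeZero N] {K : ℕ} (k : ℕ) {F' : Type*} [AddCommGroup F'] [Module ℂ F']

/-! ## §1  `π†Δπ = Δ` wherever `Δ` kills every gauge mode -/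

omit [NeZero N] in
/-- ★ **`π†Δ(U₀)π = Δ(U₀)` FOR EVERY `G′`, `Q′` AT A BACKGROUND WHOSE HESSIAN KILLS ALL GAUGE MODES** (`Δ(U₀)(D_{U₀}λ) = 0` for every `λ`): `π = 1 − D G′ R D*` differs from `1` by a
gauge mode, `Δ` is symmetric (✓`hessOpOfRecord_isSymmetric`). [cite: Balaban1985BackgroundPropagators, (3.119) p.419, (3.117) p.419, (3.10) p.392] -/
theorem hessOpOfRecordPi_eq_of_gaugeModes [Fact (0 < c0Rec F K k)] (U₀ : GaugeField (F.P K) 0 (SU N))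
    (h : ∀ l : SiteL2K ℂ (F.P K).d (fun _ => (F.P K).sitesPerDir 0) (c0Rec F K k) (WRec N),
      hessOpOfRecord F N k U₀ (covDerivL2K ℂ (c0Rec F K k) (cRec F K k) (RRec F N U₀) l) = 0)
    (Gp : SiteL2K ℂ (F.P K).d (fun _ => (F.P K).sitesPerDir 0) (c0Rec F K k) (WRec N) →ₗ[ℂ]
      SiteL2K ℂ (F.P K).d (fun _ => (F.P K).sitesPerDir 0) (c0Rec F K k) (WRec N))
    (Q' : SiteL2K ℂ (F.P K).d (fun _ => (F.P K).sitesPerDir 0) (c0Rec F K k) (WRec N) →ₗ[ℂ] F') :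
    hessOpOfRecordPi F N k U₀ Gp Q' = hessOpOfRecord F N k U₀ := by
  have hπ : ∀ w, piOfRecord F N k U₀ Gp Q' w =
      w - covDerivL2K ℂ (c0Rec F K k) (cRec F K k) (RRec F N U₀) (Gp (RrOfRecord F N k U₀ Q' (covDivL2K ℂ (c0Rec F K k) (cRec F K k) (SRec F N U₀) w))) :=
    fun w => rfl
  have hz : ∀ (l : SiteL2K ℂ (F.P K).d (fun _ => (F.P K).sitesPerDir 0) (c0Rec F K k) (WRec N)) (v),
      ⟪covDerivL2K ℂ (c0Rec F K k) (cRec F K k) (RRec F N U₀) l, hessOpOfRecord F N k U₀ v⟫_ℂ = 0 := fun l v => by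
    rw [← hessOpOfRecord_isSymmetric F N k U₀, h, inner_zero_left]
  refine LinearMap.ext fun v => ext_inner_left ℂ fun u => ?_
  rw [hessOpOfRecordPi, LinearMap.comp_apply, LinearMap.comp_apply, LinearMap.adjoint_inner_right, hπ, hπ, map_sub, h, sub_zero, inner_sub_left,
    hz, sub_zero]

/-- **AT `U₀ = 1`: `π†Δ(1)π = Δ(1)`** for every `G′`, `Q′` (g24 ✓`hessOpOfRecord_one_covDerivL2K`; also lit ✓`adjoint_pi_hessOp_one_pi`).
[cite: Balaban1985BackgroundPropagators, (3.119) p.419, (3.117) p.419] -/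
theorem hessOpOfRecordPi_one [Fact (0 < c0Rec F K k)]
    (Gp : SiteL2K ℂ (F.P K).d (fun _ => (F.P K).sitesPerDir 0) (c0Rec F K k) (WRec N) →ₗ[ℂ]
      SiteL2K ℂ (F.P K).d (fun _ => (F.P K).sitesPerDir 0) (c0Rec F K k) (WRec N))
    (Q' : SiteL2K ℂ (F.P K).d (fun _ => (F.P K).sitesPerDir 0) (c0Rec F K k) (WRec N) →ₗ[ℂ] F') :
    hessOpOfRecordPi F N k (1 : GaugeField (F.P K) 0 (SU N)) Gp Q' = hessOpOfRecord F N k 1 :=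
  hessOpOfRecordPi_eq_of_gaugeModes F N k 1 (hessOpOfRecord_one_covDerivL2K F N k) Gp Q'

/-- **ON THE FLAT ORBIT: `π†Δ(u•1)π = Δ(u•1)`** for every `G′`, `Q′` (g24 ✓`hessOpOfRecord_pureGauge_covDerivL2K`).
[cite: Balaban1985BackgroundPropagators, (3.119) p.419, (3.117) p.419, (3.30)–(3.31) p.395] -/
theorem hessOpOfRecordPi_pureGauge [Fact (0 < c0Rec F K k)] (u : GaugeTransf (F.P K) 0 (SU N))
    (Gp : SiteL2K ℂ (F.P K).d (fun _ => (F.P K).sitesPerDir 0) (c0Rec F K k) (WRec N) →ₗ[ℂ]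
      SiteL2K ℂ (F.P K).d (fun _ => (F.P K).sitesPerDir 0) (c0Rec F K k) (WRec N))
    (Q' : SiteL2K ℂ (F.P K).d (fun _ => (F.P K).sitesPerDir 0) (c0Rec F K k) (WRec N) →ₗ[ℂ] F') :
    hessOpOfRecordPi F N k (gaugeAct u 1) Gp Q' = hessOpOfRecord F N k (gaugeAct u 1) :=
  hessOpOfRecordPi_eq_of_gaugeModes F N k (gaugeAct u 1) (hessOpOfRecord_pureGauge_covDerivL2K F N k u) Gp Q'

/-- **3f′'s slot-(c) handle at `U₀ = 1`, `Δ⁽²⁾ = 0` is the bare flat Hessian.** [cite: Balaban1985BackgroundPropagators, (3.128) p.421, (3.119) p.419] -/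
theorem hessOpOfRecord128_one_zero [Fact (0 < c0Rec F K k)]
    (Gp : SiteL2K ℂ (F.P K).d (fun _ => (F.P K).sitesPerDir 0) (c0Rec F K k) (WRec N) →ₗ[ℂ]
      SiteL2K ℂ (F.P K).d (fun _ => (F.P K).sitesPerDir 0) (c0Rec F K k) (WRec N))
    (Q' : SiteL2K ℂ (F.P K).d (fun _ => (F.P K).sitesPerDir 0) (c0Rec F K k) (WRec N) →ₗ[ℂ] F') :
    hessOpOfRecord128 F N k (1 : GaugeField (F.P K) 0 (SU N)) Gp Q' 0 = hessOpOfRecord F N k 1 := by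
  rw [hessOpOfRecord128_zero, hessOpOfRecordPi_one]

/-- **3f′'s slot-(c) handle on the flat orbit, `Δ⁽²⁾ = 0`, is the bare Hessian `Δ(u•1)`.** [cite: Balaban1985BackgroundPropagators, (3.128) p.421, (3.119) p.419, (3.30) p.395] -/
theorem hessOpOfRecord128_pureGauge_zero [Fact (0 < c0Rec F K k)] (u : GaugeTransf (F.P K) 0 (SU N))
    (Gp : SiteL2K ℂ (F.P K).d (fun _ => (F.P K).sitesPerDir 0) (c0Rec F K k) (WRec N) →ₗ[ℂ]
      SiteL2K ℂ (F.P K).d (fun _ => (F.P K).sitesPerDir 0) (c0Rec F K k) (WRec N))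
    (Q' : SiteL2K ℂ (F.P K).d (fun _ => (F.P K).sitesPerDir 0) (c0Rec F K k) (WRec N) →ₗ[ℂ] F') :
    hessOpOfRecord128 F N k (gaugeAct u 1) Gp Q' 0 = hessOpOfRecord F N k (gaugeAct u 1) := by
  rw [hessOpOfRecord128_zero, hessOpOfRecordPi_pureGauge]

/-! ## §2  The displayed `hposπ` HOLDS on the flat orbit at `Δ⁽²⁾ = 0` -/

section Pos

variable [Fact (0 < c0Rec F K k)] [Fact (∀ c, 0 < wBRec F K k c)]

/-- ★★ **`hposπ` AT `U₀ = 1`, `Δ⁽²⁾ = 0`, ANY `G′`** (`0 < a`): the positivity binder of 3f′'s slot-(c) letters is g24's PROVED flat `hpos` ([B9] Thm 3.11 at `U₀ = 1`, ✓`laplaceAOfRecord_one_flat_pos`).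
[cite: Balaban1985BackgroundPropagators, Thm 3.11 p.416, Thm 3.12 p.421, (3.119) p.419; Balaban1985Variational, (110) p.294] -/
theorem laplaceAOfRecordAt128_one_zero_pos {a : ℝ} (ha : 0 < a)
    (Gp : SiteL2K ℂ (F.P K).d (fun _ => (F.P K).sitesPerDir 0) (c0Rec F K k) (WRec N) →ₗ[ℂ]
      SiteL2K ℂ (F.P K).d (fun _ => (F.P K).sitesPerDir 0) (c0Rec F K k) (WRec N))
    (x : BondL2K ℂ (F.P K).d (fun _ => (F.P K).sitesPerDir 0) (c0Rec F K k) (WRec N)) (hx : x ≠ 0) :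
    0 < RCLike.re ⟪x, laplaceAOfRecordAt F N k (1 : GaugeField (F.P K) 0 (SU N))
      (hessOpOfRecord128 F N k (1 : GaugeField (F.P K) 0 (SU N)) Gp (QflatOfRecord F N k) 0)
      (QOfRecord F N k (1 : GaugeField (F.P K) 0 (SU N))) (QflatOfRecord F N k) a x⟫_ℂ := by
  rw [hessOpOfRecord128_one_zero, laplaceAOfRecordAt_hessOpOfRecord]
  exact laplaceAOfRecord_one_flat_pos F N k ha x hx

/-- ★★ **`hposπ` ON THE FLAT ORBIT, `Δ⁽²⁾ = 0`, ANY `G′`** (`0 < a`, `k ≤ m + K`; g24 ✓`laplaceAOfRecord_pureGauge_pos`).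
[cite: Balaban1985BackgroundPropagators, Thm 3.11 p.416, Thm 3.12 p.421, (3.34) p.396; Balaban1985Variational, (110) p.294] -/
theorem laplaceAOfRecordAt128_pureGauge_zero_pos (hk : k ≤ (F.P K).m + (F.P K).K) {a : ℝ} (ha : 0 < a) (u : GaugeTransf (F.P K) 0 (SU N))
    (Gp : SiteL2K ℂ (F.P K).d (fun _ => (F.P K).sitesPerDir 0) (c0Rec F K k) (WRec N) →ₗ[ℂ]
      SiteL2K ℂ (F.P K).d (fun _ => (F.P K).sitesPerDir 0) (c0Rec F K k) (WRec N))
    (x : BondL2K ℂ (F.P K).d (fun _ => (F.P K).sitesPerDir 0) (c0Rec F K k) (WRec N)) (hx : x ≠ 0) :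
    0 < RCLike.re ⟪x, laplaceAOfRecordAt F N k (gaugeAct u 1) (hessOpOfRecord128 F N k (gaugeAct u 1) Gp (QflatOfRecord F N k) 0)
      (QOfRecord F N k (gaugeAct u 1)) (QflatOfRecord F N k) a x⟫_ℂ := by
  rw [hessOpOfRecord128_pureGauge_zero, laplaceAOfRecordAt_hessOpOfRecord]
  exact laplaceAOfRecord_pureGauge_pos F N k u hk ha x hx

end Pos

/-! ## §3  On the flat orbit, slot (b): `𝔊(u•1) f ∈ (102)` with no displayed letter -/

section Slice

variable [Fact (0 < (F.L : ℝ))] [Fact (0 < (F.P K).eta k)] [Fact (0 < c0Rec F K k)] [Fact (∀ c, 0 < wBRec F K k c)]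
  (Ω : ℕ → Set (Site (F.P K) 0)) (hk : k ≤ (F.P K).m + (F.P K).K) {a : ℝ} (ha : 0 < a) (u : GaugeTransf (F.P K) 0 (SU N))
  (T' : SiteL2K ℂ (F.P K).d (fun _ => (F.P K).sitesPerDir 0) (c0Rec F K k) (WRec N) →ₗ[ℂ] SiteL2K ℂ (F.P K).d (fun _ => (F.P K).sitesPerDir 0) (c0Rec F K k) (WRec N))
  (hpos' : ∀ x, x ≠ 0 → 0 < RCLike.re ⟪x, T' x⟫_ℂ)
  (hT' : ∀ l, QflatOfRecord F N k l = 0 → T' l = covLaplaceSiteK (cRec F K k) (RRec F N (gaugeAct u 1)) (SRec F N (gaugeAct u 1)) l)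

set_option maxRecDepth 16384 in
include hT' in
/-- ★★★ **AT `U₀ = u•1`, `Δ⁽²⁾ = 0`, PRINT'S `G′ := (T′)⁻¹`: `𝔊(u•1) f ∈ (102)` FOR EVERY CURRENT `f`, NO DISPLAYED LETTER** — ✓p819846 `frakGOfRecordAtBg128_mem_constraint102` with
`hposπ` := §2, `hQ` := ✓`QOfRecord_surjective_gaugeAct_one`, the guard := ✓`smallBelow_gaugeAct` ∘ ✓`smallBelow_one`, `Δ⁽²⁾ = 0` symmetric.
[cite: Balaban1985Variational, (102) p.293, (110)–(111) p.294, (117) p.295; Balaban1985BackgroundPropagators, (3.119) p.419, (3.124) p.420, Thm 3.11 p.416] -/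
theorem frakGOfRecordAtBg128_pureGauge_zero_mem_constraint102 (f : NegSizeLit F N K k Ω 3) :
    frakGOfRecordAtBg128 F N K k Ω (gaugeAct u 1) (greenK T' hpos') 0 a (laplaceAOfRecordAt128_pureGauge_zero_pos F N k hk ha u (greenK T' hpos'))
        (QOfRecord_surjective_gaugeAct_one hk u) f ∈
      constraint102 (L := (F.L : ℝ)) (η := (F.P K).eta k) (lev₀ := bondLevLit F Ω k) (pairLevLit F Ω k)
        (nabla115 ((F.P K).eta k) (unitsOfRecord F N (gaugeAct u 1)))
        (QFun (phiRec N) (QOfRecord F N k (gaugeAct u 1)))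
        (B11Eq103H1Complex.RLatticeK (cRec F K k) (RRec F N (gaugeAct u 1)) (SRec F N (gaugeAct u 1)) (QflatOfRecord F N k))
        (DstarFun (phiRec N) (covDivL2K ℂ (c0Rec F K k) (cRec F K k) (SRec F N (gaugeAct u 1)))) :=
  frakGOfRecordAtBg128_mem_constraint102 F N k Ω (gaugeAct u 1) T' hpos' hT' LinearMap.IsSymmetric.zero
    (laplaceAOfRecordAt128_pureGauge_zero_pos F N k hk ha u (greenK T' hpos')) (QOfRecord_surjective_gaugeAct_one hk u)
    (smallBelow_gaugeAct hk u (smallBelow_one N k)) f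

end Slice

end Summit.QuantumFields.YangMills.Theorems.N07HessOpOfRecordPiFlat
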